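import Summits.Ventures.AbcSig.Rows.TemplateC2a

/-!
# Venture AbcSig — TWO-DISTRIBUTION templates: `A xⁿ + B yⁿ = z²` with `A` odd and the power of `2` in `B`

HONEST FRAMING. `pub-abcsig` is a COMPUTATION cell; nothing here bears on ABC or any summit. This file generalises the
branch lemmas of `Rows/TemplateB.lean` (coefficients `(1, B)`) to coefficients `(A, B)` with `A` odd — the SECOND
coefficient distribution of the census C2a cells (`A·B = 2^a·ℓ^m` with `(A, B) = (ℓ^m, 2^a)`, i.e. the equation
`ℓ^m xⁿ + 2^a yⁿ = z²`), which the landed rows `row_C2aL<ℓ>A6` (distribution `A = 1`) do not cover. Everything is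
CONDITIONAL on the same hypotheses as before: `NewformModel.BS04Package` (CITED: [BS04] Lemma 3.3 + Prop 4.3, packaged),
`DataComplete N orbs` (COMPUTED: the generated level files — the SAME files serve both distributions, because the
coarse sieve `bs04Allowed` does not depend on the solution and `bs04OddLevel` depends on `rad(AB)` only), and per-orbit
`Excludes` hypotheses for the family `famAB A B n P` where a row needs them. Reference: [BS04] Bennett–Skinner, Canad.
J. Math. 56 (2004), Lemmas 2.1, 3.2, 3.3 (cases (ii)–(v) carry the power of `2` in `B bⁿ`; `A a` odd).
-/

namespace Summit.Ventures.AbcSig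

/-- The family predicate for coefficients `(A, B)` — or `(B, A)` with the variables swapped — `C = 1`, exponent `n`,
and a row-chosen condition `P x y` on the solution in the orientation `A xⁿ + B yⁿ = z²`. -/
def famAB (A B n : ℕ) (P : ℤ → ℤ → Prop) (S : FreyDatum) : Prop :=
  ((S.A = A ∧ S.B = B ∧ P S.a S.b) ∨ (S.A = B ∧ S.B = A ∧ P S.b S.a)) ∧ S.C = 1 ∧ S.n = n

/-- In a primitive solution of `A xⁿ + B yⁿ = C z²` with `B y` even, `z` is odd. -/
theorem odd_z_of_two_dvd_By' {A B C n : ℕ} {x y z : ℤ} (h : IsPrimitiveSolution A B C n x y z)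
    (h2 : 2 ∣ (B : ℤ) * y) : ¬ 2 ∣ z := by
  intro hz
  obtain ⟨-, -, -, -, -, -, hbc⟩ := h
  have hu := hbc.isUnit_of_dvd' h2 (Dvd.dvd.mul_left hz _)
  rcases Int.isUnit_iff.mp hu with h | h <;> omega

/-- In a primitive solution of `A xⁿ + B yⁿ = C z²` with `B` even, `x` is odd. -/
theorem odd_x_of_even_B' {A B C n : ℕ} {x y z : ℤ} (h : IsPrimitiveSolution A B C n x y z) (hB : 2 ∣ (B : ℤ)) :
    ¬ 2 ∣ x := by
  intro hx
  obtain ⟨-, -, -, -, hab, -, -⟩ := h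
  have hu := hab.isUnit_of_dvd' (Dvd.dvd.mul_left hx _) (hB.mul_right y)
  rcases Int.isUnit_iff.mp hu with h | h <;> omega

/-- **Branch (v₇), coefficients `(A, B)`: `2⁷ ∣ B yⁿ`.** Level `N = bs04Level v₇ A B 1 n`. -/
theorem branchAB_v7 (A B : ℕ) (hA : 0 < A) (hB : 0 < B) (M : NewformModel) (hP : M.BS04Package) (n : ℕ)
    (hn : n.Prime) (h7 : 7 ≤ n) (hnAB : ¬ n ∣ A * B) (hfree : ∀ q : ℕ, q.Prime → ¬ q ^ n ∣ A ∧ ¬ q ^ n ∣ B)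
    (N : ℕ) (hN : bs04Level .v₇ A B 1 n = N) (P : ℤ → ℤ → Prop) {orbs : List OrbitData}
    (hD : M.DataComplete N orbs)
    (hS : ∀ o ∈ orbs, (∀ e ∈ o.coeffs, e.ell.Prime ∧ e.ell ≠ 2 ∧ ¬ e.ell ∣ N) ∧
      (o.Eliminated bs04Allowed n ∨ M.Excludes N o (famAB A B n P)))
    (x y z : ℤ) (hPxy : P x y) (hv : (2 : ℤ) ^ 7 ∣ B * y ^ n) (hxy1 : x * y ≠ 1) (hxy2 : x * y ≠ -1) :
    ¬ IsPrimitiveSolution A B 1 n x y z := by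
  intro hsol
  have h2 : 2 ∣ (B : ℤ) * y := two_dvd_By_of_pow ((dvd_pow_self 2 (by norm_num)).trans hv)
  have hz := odd_z_of_two_dvd_By' hsol h2
  obtain ⟨z', hz'sgn, hz'⟩ := exists_sign_sub_four_dvd_int z 1 hz (by omega)
  have hsol' : IsPrimitiveSolution A B 1 n x y z' := hsol.of_sign hz'sgn
  have hcase : FreyCase.Holds .v₇ A B 1 n x y z' := ⟨hv, by simpa using hz'⟩
  exact no_solution_in_case M hP ⟨A, B, 1, n, x, y, z'⟩ .v₇ N hA hB one_pos squarefree_one hn h7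
    (by simpa using hnAB) hfree hsol' hxy1 hxy2 hcase hN hD (famAB A B n P) ⟨Or.inl ⟨rfl, rfl, hPxy⟩, rfl, rfl⟩ hS

/-- **Branch (v₆), coefficients `(A, B)`: `ord₂(B yⁿ) = 6`.** Level `N = bs04Level v₆ A B 1 n`. -/
theorem branchAB_v6 (A B : ℕ) (hA : 0 < A) (hB : 0 < B) (M : NewformModel) (hP : M.BS04Package) (n : ℕ)
    (hn : n.Prime) (h7 : 7 ≤ n) (hnAB : ¬ n ∣ A * B) (hfree : ∀ q : ℕ, q.Prime → ¬ q ^ n ∣ A ∧ ¬ q ^ n ∣ B)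
    (N : ℕ) (hN : bs04Level .v₆ A B 1 n = N) (P : ℤ → ℤ → Prop) {orbs : List OrbitData}
    (hD : M.DataComplete N orbs)
    (hS : ∀ o ∈ orbs, (∀ e ∈ o.coeffs, e.ell.Prime ∧ e.ell ≠ 2 ∧ ¬ e.ell ∣ N) ∧
      (o.Eliminated bs04Allowed n ∨ M.Excludes N o (famAB A B n P)))
    (x y z : ℤ) (hPxy : P x y) (hv : OrdTwoEq (B * y ^ n) 6) (hxy1 : x * y ≠ 1) (hxy2 : x * y ≠ -1) :
    ¬ IsPrimitiveSolution A B 1 n x y z := by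
  intro hsol
  have h2 : 2 ∣ (B : ℤ) * y := two_dvd_By_of_pow ((dvd_pow_self 2 (by norm_num)).trans hv.1)
  have hz := odd_z_of_two_dvd_By' hsol h2
  obtain ⟨z', hz'sgn, hz'⟩ := exists_sign_sub_four_dvd_int z 1 hz (by omega)
  have hsol' : IsPrimitiveSolution A B 1 n x y z' := hsol.of_sign hz'sgn
  have hcase : FreyCase.Holds .v₆ A B 1 n x y z' := ⟨hv, by simpa using hz'⟩
  exact no_solution_in_case M hP ⟨A, B, 1, n, x, y, z'⟩ .v₆ N hA hB one_pos squarefree_one hn h7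
    (by simpa using hnAB) hfree hsol' hxy1 hxy2 hcase hN hD (famAB A B n P) ⟨Or.inl ⟨rfl, rfl, hPxy⟩, rfl, rfl⟩ hS

/-- **Branch (iv), coefficients `(A, B)`, `ord₂ B ∈ {4, 5}`, `xy` odd.** Level `N = bs04Level iv₄₅ A B 1 n`. -/
theorem branchAB_iv45 (A B : ℕ) (hA : 0 < A) (hB : 0 < B) (M : NewformModel) (hP : M.BS04Package) (n : ℕ)
    (hn : n.Prime) (h7 : 7 ≤ n) (hnAB : ¬ n ∣ A * B) (hfree : ∀ q : ℕ, q.Prime → ¬ q ^ n ∣ A ∧ ¬ q ^ n ∣ B)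
    (N : ℕ) (hN : bs04Level .iv₄₅ A B 1 n = N) (P : ℤ → ℤ → Prop) {orbs : List OrbitData}
    (hD : M.DataComplete N orbs)
    (hS : ∀ o ∈ orbs, (∀ e ∈ o.coeffs, e.ell.Prime ∧ e.ell ≠ 2 ∧ ¬ e.ell ∣ N) ∧
      (o.Eliminated bs04Allowed n ∨ M.Excludes N o (famAB A B n P)))
    (x y z : ℤ) (hPxy : P x y) (hB45 : OrdTwoEq B 4 ∨ OrdTwoEq B 5) (hxy : ¬ 2 ∣ x * y)
    (h1 : x * y ≠ 1) (h2 : x * y ≠ -1) :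
    ¬ IsPrimitiveSolution A B 1 n x y z := by
  intro hsol
  have hB2 : 2 ∣ (B : ℤ) := by
    rcases hB45 with h | h
    · exact (dvd_pow_self 2 (by norm_num)).trans h.1
    · exact (dvd_pow_self 2 (by norm_num)).trans h.1
  have hz := odd_z_of_two_dvd_By' hsol (hB2.mul_right y)
  obtain ⟨z', hz'sgn, hz'⟩ := exists_sign_sub_four_dvd_int z 1 hz (by omega)
  have hsol' : IsPrimitiveSolution A B 1 n x y z' := hsol.of_sign hz'sgn
  have hcase : FreyCase.Holds .iv₄₅ A B 1 n x y z' := ⟨hxy, hB45, by simpa using hz'⟩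
  exact no_solution_in_case M hP ⟨A, B, 1, n, x, y, z'⟩ .iv₄₅ N hA hB one_pos squarefree_one hn h7
    (by simpa using hnAB) hfree hsol' h1 h2 hcase hN hD (famAB A B n P) ⟨Or.inl ⟨rfl, rfl, hPxy⟩, rfl, rfl⟩ hS

/-- **Branch (iv), coefficients `(A, B)`, `ord₂ B = 3`, `xy` odd.** Level `N = bs04Level iv₃ A B 1 n`. -/
theorem branchAB_iv3 (A B : ℕ) (hA : 0 < A) (hB : 0 < B) (M : NewformModel) (hP : M.BS04Package) (n : ℕ)
    (hn : n.Prime) (h7 : 7 ≤ n) (hnAB : ¬ n ∣ A * B) (hfree : ∀ q : ℕ, q.Prime → ¬ q ^ n ∣ A ∧ ¬ q ^ n ∣ B)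
    (N : ℕ) (hN : bs04Level .iv₃ A B 1 n = N) (P : ℤ → ℤ → Prop) {orbs : List OrbitData}
    (hD : M.DataComplete N orbs)
    (hS : ∀ o ∈ orbs, (∀ e ∈ o.coeffs, e.ell.Prime ∧ e.ell ≠ 2 ∧ ¬ e.ell ∣ N) ∧
      (o.Eliminated bs04Allowed n ∨ M.Excludes N o (famAB A B n P)))
    (x y z : ℤ) (hPxy : P x y) (hB3 : OrdTwoEq B 3) (hxy : ¬ 2 ∣ x * y) (h1 : x * y ≠ 1) (h2 : x * y ≠ -1) :
    ¬ IsPrimitiveSolution A B 1 n x y z := by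
  intro hsol
  have hB2 : 2 ∣ (B : ℤ) := (dvd_pow_self 2 (by norm_num)).trans hB3.1
  have hz := odd_z_of_two_dvd_By' hsol (hB2.mul_right y)
  obtain ⟨z', hz'sgn, hz'⟩ := exists_sign_sub_four_dvd_int z 1 hz (by omega)
  have hsol' : IsPrimitiveSolution A B 1 n x y z' := hsol.of_sign hz'sgn
  have hcase : FreyCase.Holds .iv₃ A B 1 n x y z' := ⟨hxy, hB3, by simpa using hz'⟩
  exact no_solution_in_case M hP ⟨A, B, 1, n, x, y, z'⟩ .iv₃ N hA hB one_pos squarefree_one hn h7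
    (by simpa using hnAB) hfree hsol' h1 h2 hcase hN hD (famAB A B n P) ⟨Or.inl ⟨rfl, rfl, hPxy⟩, rfl, rfl⟩ hS

/-- **Branch (ii), coefficients `(A, B)`, `ord₂ B = 1`, `xy` odd.** Level `N = bs04Level iiB A B 1 n`. -/
theorem branchAB_iiB (A B : ℕ) (hA : 0 < A) (hB : 0 < B) (M : NewformModel) (hP : M.BS04Package) (n : ℕ)
    (hn : n.Prime) (h7 : 7 ≤ n) (hnAB : ¬ n ∣ A * B) (hfree : ∀ q : ℕ, q.Prime → ¬ q ^ n ∣ A ∧ ¬ q ^ n ∣ B)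
    (N : ℕ) (hN : bs04Level .iiB A B 1 n = N) (P : ℤ → ℤ → Prop) {orbs : List OrbitData}
    (hD : M.DataComplete N orbs)
    (hS : ∀ o ∈ orbs, (∀ e ∈ o.coeffs, e.ell.Prime ∧ e.ell ≠ 2 ∧ ¬ e.ell ∣ N) ∧
      (o.Eliminated bs04Allowed n ∨ M.Excludes N o (famAB A B n P)))
    (x y z : ℤ) (hPxy : P x y) (hB1 : OrdTwoEq B 1) (hxy : ¬ 2 ∣ x * y) (h1 : x * y ≠ 1) (h2 : x * y ≠ -1) :
    ¬ IsPrimitiveSolution A B 1 n x y z := by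
  intro hsol
  have hcase : FreyCase.Holds .iiB A B 1 n x y z := ⟨hxy, hB1⟩
  exact no_solution_in_case M hP ⟨A, B, 1, n, x, y, z⟩ .iiB N hA hB one_pos squarefree_one hn h7
    (by simpa using hnAB) hfree hsol h1 h2 hcase hN hD (famAB A B n P) ⟨Or.inl ⟨rfl, rfl, hPxy⟩, rfl, rfl⟩ hS

/-- **Branch (iii), coefficients `(A, B)`, `ord₂ B = 2`, `xy` odd:** after fixing the sign of `z`, the datum is in case
(iii₁) (level `N₁`) or (iii₂) (level `N₂`); both levels are needed. -/
theorem branchAB_iii (A B : ℕ) (hA : 0 < A) (hB : 0 < B) (M : NewformModel) (hP : M.BS04Package) (n : ℕ)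
    (hn : n.Prime) (h7 : 7 ≤ n) (hnAB : ¬ n ∣ A * B) (hfree : ∀ q : ℕ, q.Prime → ¬ q ^ n ∣ A ∧ ¬ q ^ n ∣ B)
    (N₁ N₂ : ℕ) (hN₁ : bs04Level .iii₁ A B 1 n = N₁) (hN₂ : bs04Level .iii₂ A B 1 n = N₂) (P : ℤ → ℤ → Prop)
    {orbs₁ orbs₂ : List OrbitData} (hD₁ : M.DataComplete N₁ orbs₁) (hD₂ : M.DataComplete N₂ orbs₂)
    (hS₁ : ∀ o ∈ orbs₁, (∀ e ∈ o.coeffs, e.ell.Prime ∧ e.ell ≠ 2 ∧ ¬ e.ell ∣ N₁) ∧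
      (o.Eliminated bs04Allowed n ∨ M.Excludes N₁ o (famAB A B n P)))
    (hS₂ : ∀ o ∈ orbs₂, (∀ e ∈ o.coeffs, e.ell.Prime ∧ e.ell ≠ 2 ∧ ¬ e.ell ∣ N₂) ∧
      (o.Eliminated bs04Allowed n ∨ M.Excludes N₂ o (famAB A B n P)))
    (x y z : ℤ) (hPxy : P x y) (hB2 : OrdTwoEq B 2) (hxy : ¬ 2 ∣ x * y) (h1 : x * y ≠ 1) (h2 : x * y ≠ -1) :
    ¬ IsPrimitiveSolution A B 1 n x y z := by
  intro hsol
  have hy : ¬ 2 ∣ y := fun h => hxy (Dvd.dvd.mul_left h x)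
  obtain ⟨h4B, h8B⟩ := hB2
  have h4 : (4 : ℤ) ∣ (B : ℤ) := by simpa using h4B
  have h8 : ¬ (8 : ℤ) ∣ (B : ℤ) := by simpa using h8B
  have h4n : 4 ∣ B := by exact_mod_cast h4
  have hBq : (B : ℤ) = 4 * ((B / 4 : ℕ) : ℤ) := by
    have : B = 4 * (B / 4) := (Nat.mul_div_cancel' h4n).symm
    exact_mod_cast this
  have hqodd : ¬ 2 ∣ ((B / 4 : ℕ) : ℤ) := by
    intro h
    apply h8
    obtain ⟨k, hk⟩ := h
    exact ⟨k, by rw [hBq, hk]; ring⟩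
  have h2By : 2 ∣ (B : ℤ) * y := by
    rw [hBq]
    exact ⟨2 * ((B / 4 : ℕ) : ℤ) * y, by ring⟩
  have hz := odd_z_of_two_dvd_By' hsol h2By
  have ht : ¬ 2 ∣ -(y * ((B / 4 : ℕ) : ℤ)) := by
    intro h
    rw [dvd_neg] at h
    rcases Int.prime_two.dvd_mul.mp h with h | h
    · exact hy h
    · exact hqodd h
  obtain ⟨z', hz'sgn, hz'⟩ := exists_sign_sub_four_dvd_int z _ hz ht
  have hsol' : IsPrimitiveSolution A B 1 n x y z' := hsol.of_sign hz'sgn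
  have hzc : (4 : ℤ) ∣ z' + y * ((B / 4 : ℕ) : ℤ) := by
    have : z' + y * ((B / 4 : ℕ) : ℤ) = z' - -(y * ((B / 4 : ℕ) : ℤ)) := by ring
    rw [this]; exact hz'
  by_cases hsplit : (4 : ℤ) ∣ y + ((B / 4 : ℕ) : ℤ) * ((1 : ℕ) : ℤ)
  · have hcase : FreyCase.Holds .iii₁ A B 1 n x y z' := ⟨hxy, ⟨h4B, h8B⟩, hzc, hsplit⟩
    exact no_solution_in_case M hP ⟨A, B, 1, n, x, y, z'⟩ .iii₁ N₁ hA hB one_pos squarefree_one hn h7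
      (by simpa using hnAB) hfree hsol' h1 h2 hcase hN₁ hD₁ (famAB A B n P) ⟨Or.inl ⟨rfl, rfl, hPxy⟩, rfl, rfl⟩ hS₁
  · have hsplit' : (4 : ℤ) ∣ y - ((B / 4 : ℕ) : ℤ) * ((1 : ℕ) : ℤ) := by
      push_cast at hsplit ⊢
      omega
    have hcase : FreyCase.Holds .iii₂ A B 1 n x y z' := ⟨hxy, ⟨h4B, h8B⟩, hzc, hsplit'⟩
    exact no_solution_in_case M hP ⟨A, B, 1, n, x, y, z'⟩ .iii₂ N₂ hA hB one_pos squarefree_one hn h7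
      (by simpa using hnAB) hfree hsol' h1 h2 hcase hN₂ hD₂ (famAB A B n P) ⟨Or.inl ⟨rfl, rfl, hPxy⟩, rfl, rfl⟩ hS₂

/-! ## The distribution `(A, B) = (ℓ^m, 2^a)` of census line C2a: `ℓ^m xⁿ + 2^a yⁿ = z²` -/

/-- Odd part of the level for coefficients `(ℓ^m, 2^a, 1)`: `ℓ` (prime `ℓ ≠ 2`, `m ≥ 1`, `n ≠ ℓ`). -/
theorem bs04OddLevel_primePow_twoPow (ℓ a m n : ℕ) (hℓ : ℓ.Prime) (hℓ2 : ℓ ≠ 2) (hm : 1 ≤ m) (hn : n ≠ ℓ) :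
    bs04OddLevel (ℓ ^ m) (2 ^ a) 1 n = ℓ := by
  have h := (bs04OddLevel_twoPow_primePow ℓ a m n hℓ hℓ2 hm hn).1
  unfold bs04OddLevel at h ⊢
  rw [mul_comm (ℓ ^ m) (2 ^ a)]
  rwa [one_mul] at h

/-- The numeric levels for `(A, B) = (ℓ^m, 2^a)` in the cases with `B yⁿ` even. -/
theorem levelsC2aAB (ℓ : ℕ) (hℓ : ℓ.Prime) (hℓ2 : ℓ ≠ 2) (n : ℕ) (hnℓ : n ≠ ℓ) (a m : ℕ) (hm : 1 ≤ m) :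
    bs04Level .v₇ (ℓ ^ m) (2 ^ a) 1 n = 2 * ℓ ∧ bs04Level .v₆ (ℓ ^ m) (2 ^ a) 1 n = ℓ ∧
    bs04Level .iv₄₅ (ℓ ^ m) (2 ^ a) 1 n = 8 * ℓ ∧ bs04Level .iv₃ (ℓ ^ m) (2 ^ a) 1 n = 32 * ℓ ∧
    bs04Level .iii₁ (ℓ ^ m) (2 ^ a) 1 n = 4 * ℓ ∧ bs04Level .iii₂ (ℓ ^ m) (2 ^ a) 1 n = 8 * ℓ ∧
    bs04Level .iiB (ℓ ^ m) (2 ^ a) 1 n = 128 * ℓ := by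
  have h1 := bs04OddLevel_primePow_twoPow ℓ a m n hℓ hℓ2 hm hnℓ
  simp only [bs04Level, FreyCase.twoExp, h1]
  norm_num

/-- Side conditions of `BS04Package` for `(A, B) = (ℓ^m, 2^a)` with `a, m < n`, `n ∉ {2, ℓ}` prime. -/
theorem sideAB (ℓ a m n : ℕ) (hℓ : ℓ.Prime) (hℓ2 : ℓ ≠ 2) (hn : n.Prime) (hn2 : n ≠ 2) (hnℓ : n ≠ ℓ)
    (han : a < n) (hmn : m < n) :
    0 < ℓ ^ m ∧ 0 < 2 ^ a ∧ ¬ n ∣ ℓ ^ m * 2 ^ a ∧ (∀ q : ℕ, q.Prime → ¬ q ^ n ∣ ℓ ^ m ∧ ¬ q ^ n ∣ 2 ^ a) := by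
  have hfreeB := nthPowerFree_twoPow_primePow ℓ a m n hℓ hℓ2 han hmn
  refine ⟨pow_pos hℓ.pos m, pow_pos two_pos a, ?_, fun q hq => ⟨?_, ?_⟩⟩
  · rw [mul_comm]; exact not_dvd_twoPow_primePow ℓ a m n hℓ hn hn2 hnℓ
  · exact fun h => hfreeB q hq (h.trans (dvd_mul_left _ _))
  · exact fun h => hfreeB q hq (h.trans (dvd_mul_right _ _))

/-- Distribution `(ℓ^m, 2^a)`, the `y`-EVEN half of any class `a` (level `2ℓ`, case (v₇) since `n ≥ 7`). -/
theorem rowC2aAB_yeven (ℓ : ℕ) (hℓ : ℓ.Prime) (hℓ2 : ℓ ≠ 2) (M : NewformModel) (hP : M.BS04Package)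
    (n : ℕ) (hn : n.Prime) (h7 : 7 ≤ n) (hnℓ : n ≠ ℓ) {orbs2 : List OrbitData} (hD2 : M.DataComplete (2 * ℓ) orbs2)
    (a m : ℕ) (hm : 1 ≤ m) (han : a < n) (hmn : m < n)
    (hS2 : ∀ o ∈ orbs2, (∀ e ∈ o.coeffs, e.ell.Prime ∧ e.ell ≠ 2 ∧ ¬ e.ell ∣ 2 * ℓ) ∧
      (o.Eliminated bs04Allowed n ∨ M.Excludes (2 * ℓ) o (famAB (ℓ ^ m) (2 ^ a) n (fun _ _ => True))))
    (x y z : ℤ) (hy : 2 ∣ y) (hxy1 : x * y ≠ 1) (hxy2 : x * y ≠ -1) :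
    ¬ IsPrimitiveSolution (ℓ ^ m) (2 ^ a) 1 n x y z := by
  obtain ⟨hA, hB, hnAB, hfree⟩ := sideAB ℓ a m n hℓ hℓ2 hn (by omega) hnℓ han hmn
  have hL := (levelsC2aAB ℓ hℓ hℓ2 n hnℓ a m hm).1
  have hv : (2 : ℤ) ^ 7 ∣ ((2 ^ a : ℕ) : ℤ) * y ^ n :=
    Dvd.dvd.mul_left ((pow_dvd_pow 2 h7).trans (pow_dvd_pow_of_dvd hy n)) _
  exact branchAB_v7 _ _ hA hB M hP n hn h7 hnAB hfree (2 * ℓ) hL (fun _ _ => True) hD2 hS2 x y z trivial hv hxy1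
    hxy2

/-- Distribution `(ℓ^m, 2^a)`, **class `a ≥ 7`** (level `2ℓ` only). -/
theorem rowC2aAB_age7 (ℓ : ℕ) (hℓ : ℓ.Prime) (hℓ2 : ℓ ≠ 2) (M : NewformModel) (hP : M.BS04Package)
    (n : ℕ) (hn : n.Prime) (h7 : 7 ≤ n) (hnℓ : n ≠ ℓ) {orbs2 : List OrbitData} (hD2 : M.DataComplete (2 * ℓ) orbs2)
    (a m : ℕ) (ha : 7 ≤ a) (hm : 1 ≤ m) (han : a < n) (hmn : m < n)
    (hS2 : ∀ o ∈ orbs2, (∀ e ∈ o.coeffs, e.ell.Prime ∧ e.ell ≠ 2 ∧ ¬ e.ell ∣ 2 * ℓ) ∧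
      (o.Eliminated bs04Allowed n ∨ M.Excludes (2 * ℓ) o (famAB (ℓ ^ m) (2 ^ a) n (fun _ _ => True))))
    (x y z : ℤ) (hxy1 : x * y ≠ 1) (hxy2 : x * y ≠ -1) : ¬ IsPrimitiveSolution (ℓ ^ m) (2 ^ a) 1 n x y z := by
  obtain ⟨hA, hB, hnAB, hfree⟩ := sideAB ℓ a m n hℓ hℓ2 hn (by omega) hnℓ han hmn
  have hL := (levelsC2aAB ℓ hℓ hℓ2 n hnℓ a m hm).1
  have hv : (2 : ℤ) ^ 7 ∣ ((2 ^ a : ℕ) : ℤ) * y ^ n := by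
    have h' : (2 : ℤ) ^ 7 ∣ ((2 ^ a : ℕ) : ℤ) := by push_cast; exact pow_dvd_pow 2 ha
    exact h'.mul_right _
  exact branchAB_v7 _ _ hA hB M hP n hn h7 hnAB hfree (2 * ℓ) hL (fun _ _ => True) hD2 hS2 x y z trivial hv hxy1
    hxy2

/-- Distribution `(ℓ^m, 2^a)`, **class `a = 6`** (levels `ℓ` for `y` odd, `2ℓ` for `y` even). In the `y`-even
sub-case the printed level `2ℓ` is used AS PRINTED ([BS04, Lemma 3.3]; see the cell's ERRATA E3 addendum for why the
statement holds there although the Serre conductor is `ℓ`). -/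
theorem rowC2aAB_a6 (ℓ : ℕ) (hℓ : ℓ.Prime) (hℓ2 : ℓ ≠ 2) (M : NewformModel) (hP : M.BS04Package)
    (n : ℕ) (hn : n.Prime) (h7 : 7 ≤ n) (hnℓ : n ≠ ℓ) {orbs1 orbs2 : List OrbitData} (hD1 : M.DataComplete ℓ orbs1)
    (hD2 : M.DataComplete (2 * ℓ) orbs2) (m : ℕ) (hm : 1 ≤ m) (hmn : m < n)
    (hS1 : ∀ o ∈ orbs1, (∀ e ∈ o.coeffs, e.ell.Prime ∧ e.ell ≠ 2 ∧ ¬ e.ell ∣ ℓ) ∧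
      (o.Eliminated bs04Allowed n ∨ M.Excludes ℓ o (famAB (ℓ ^ m) (2 ^ 6) n (fun _ _ => True))))
    (hS2 : ∀ o ∈ orbs2, (∀ e ∈ o.coeffs, e.ell.Prime ∧ e.ell ≠ 2 ∧ ¬ e.ell ∣ 2 * ℓ) ∧
      (o.Eliminated bs04Allowed n ∨ M.Excludes (2 * ℓ) o (famAB (ℓ ^ m) (2 ^ 6) n (fun _ _ => True))))
    (x y z : ℤ) (hxy1 : x * y ≠ 1) (hxy2 : x * y ≠ -1) : ¬ IsPrimitiveSolution (ℓ ^ m) (2 ^ 6) 1 n x y z := by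
  intro hsol
  by_cases hy : 2 ∣ y
  · exact rowC2aAB_yeven ℓ hℓ hℓ2 M hP n hn h7 hnℓ hD2 6 m hm (by omega) hmn hS2 x y z hy hxy1 hxy2 hsol
  obtain ⟨hA, hB, hnAB, hfree⟩ := sideAB ℓ 6 m n hℓ hℓ2 hn (by omega) hnℓ (by omega) hmn
  obtain ⟨-, hL1, -⟩ := levelsC2aAB ℓ hℓ hℓ2 n hnℓ 6 m hm
  have hv : OrdTwoEq (((2 ^ 6 : ℕ) : ℤ) * y ^ n) 6 := by
    push_cast
    exact ordTwoEq_twoPow_mul_odd 6 _ (not_two_dvd_pow hy n)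
  exact branchAB_v6 _ _ hA hB M hP n hn h7 hnAB hfree ℓ hL1 (fun _ _ => True) hD1 hS1 x y z trivial hv hxy1 hxy2
    hsol

/-- Distribution `(ℓ^m, 2^a)`, **class `a ∈ {4, 5}`** (levels `8ℓ` for `y` odd, `2ℓ` for `y` even). -/
theorem rowC2aAB_a45 (ℓ : ℕ) (hℓ : ℓ.Prime) (hℓ2 : ℓ ≠ 2) (M : NewformModel) (hP : M.BS04Package)
    (n : ℕ) (hn : n.Prime) (h7 : 7 ≤ n) (hnℓ : n ≠ ℓ) {orbs8 orbs2 : List OrbitData}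
    (hD8 : M.DataComplete (8 * ℓ) orbs8) (hD2 : M.DataComplete (2 * ℓ) orbs2) (a m : ℕ) (ha : a = 4 ∨ a = 5)
    (hm : 1 ≤ m) (han : a < n) (hmn : m < n)
    (hS8 : ∀ o ∈ orbs8, (∀ e ∈ o.coeffs, e.ell.Prime ∧ e.ell ≠ 2 ∧ ¬ e.ell ∣ 8 * ℓ) ∧
      (o.Eliminated bs04Allowed n ∨ M.Excludes (8 * ℓ) o (famAB (ℓ ^ m) (2 ^ a) n (fun _ _ => True))))
    (hS2 : ∀ o ∈ orbs2, (∀ e ∈ o.coeffs, e.ell.Prime ∧ e.ell ≠ 2 ∧ ¬ e.ell ∣ 2 * ℓ) ∧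
      (o.Eliminated bs04Allowed n ∨ M.Excludes (2 * ℓ) o (famAB (ℓ ^ m) (2 ^ a) n (fun _ _ => True))))
    (x y z : ℤ) (hxy1 : x * y ≠ 1) (hxy2 : x * y ≠ -1) : ¬ IsPrimitiveSolution (ℓ ^ m) (2 ^ a) 1 n x y z := by
  intro hsol
  by_cases hy : 2 ∣ y
  · exact rowC2aAB_yeven ℓ hℓ hℓ2 M hP n hn h7 hnℓ hD2 a m hm han hmn hS2 x y z hy hxy1 hxy2 hsol
  obtain ⟨hA, hB, hnAB, hfree⟩ := sideAB ℓ a m n hℓ hℓ2 hn (by omega) hnℓ han hmn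
  obtain ⟨-, -, hL8, -⟩ := levelsC2aAB ℓ hℓ hℓ2 n hnℓ a m hm
  have hBeven : 2 ∣ ((2 ^ a : ℕ) : ℤ) := by
    push_cast
    rcases ha with rfl | rfl <;> norm_num
  have hx := odd_x_of_even_B' hsol hBeven
  have hxy : ¬ 2 ∣ x * y := not_two_dvd_mul hx hy
  have hB45 : OrdTwoEq ((2 ^ a : ℕ) : ℤ) 4 ∨ OrdTwoEq ((2 ^ a : ℕ) : ℤ) 5 := by
    rcases ha with rfl | rfl
    · left
      have : ((2 ^ 4 : ℕ) : ℤ) = 2 ^ 4 * 1 := by norm_num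
      rw [this]; exact ordTwoEq_twoPow_mul_odd 4 1 (by omega)
    · right
      have : ((2 ^ 5 : ℕ) : ℤ) = 2 ^ 5 * 1 := by norm_num
      rw [this]; exact ordTwoEq_twoPow_mul_odd 5 1 (by omega)
  exact branchAB_iv45 _ _ hA hB M hP n hn h7 hnAB hfree (8 * ℓ) hL8 (fun _ _ => True) hD8 hS8 x y z trivial hB45
    hxy hxy1 hxy2 hsol

/-- Distribution `(ℓ^m, 2^a)`, **class `a = 3`** (levels `32ℓ` for `y` odd, `2ℓ` for `y` even). -/
theorem rowC2aAB_a3 (ℓ : ℕ) (hℓ : ℓ.Prime) (hℓ2 : ℓ ≠ 2) (M : NewformModel) (hP : M.BS04Package)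
    (n : ℕ) (hn : n.Prime) (h7 : 7 ≤ n) (hnℓ : n ≠ ℓ) {orbs32 orbs2 : List OrbitData}
    (hD32 : M.DataComplete (32 * ℓ) orbs32) (hD2 : M.DataComplete (2 * ℓ) orbs2) (m : ℕ) (hm : 1 ≤ m) (hmn : m < n)
    (hS32 : ∀ o ∈ orbs32, (∀ e ∈ o.coeffs, e.ell.Prime ∧ e.ell ≠ 2 ∧ ¬ e.ell ∣ 32 * ℓ) ∧
      (o.Eliminated bs04Allowed n ∨ M.Excludes (32 * ℓ) o (famAB (ℓ ^ m) (2 ^ 3) n (fun _ _ => True))))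
    (hS2 : ∀ o ∈ orbs2, (∀ e ∈ o.coeffs, e.ell.Prime ∧ e.ell ≠ 2 ∧ ¬ e.ell ∣ 2 * ℓ) ∧
      (o.Eliminated bs04Allowed n ∨ M.Excludes (2 * ℓ) o (famAB (ℓ ^ m) (2 ^ 3) n (fun _ _ => True))))
    (x y z : ℤ) (hxy1 : x * y ≠ 1) (hxy2 : x * y ≠ -1) : ¬ IsPrimitiveSolution (ℓ ^ m) (2 ^ 3) 1 n x y z := by
  intro hsol
  by_cases hy : 2 ∣ y
  · exact rowC2aAB_yeven ℓ hℓ hℓ2 M hP n hn h7 hnℓ hD2 3 m hm (by omega) hmn hS2 x y z hy hxy1 hxy2 hsol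
  obtain ⟨hA, hB, hnAB, hfree⟩ := sideAB ℓ 3 m n hℓ hℓ2 hn (by omega) hnℓ (by omega) hmn
  obtain ⟨-, -, -, hL32, -⟩ := levelsC2aAB ℓ hℓ hℓ2 n hnℓ 3 m hm
  have hBeven : 2 ∣ ((2 ^ 3 : ℕ) : ℤ) := by norm_num
  have hx := odd_x_of_even_B' hsol hBeven
  have hxy : ¬ 2 ∣ x * y := not_two_dvd_mul hx hy
  have hB3 : OrdTwoEq ((2 ^ 3 : ℕ) : ℤ) 3 := by
    have : ((2 ^ 3 : ℕ) : ℤ) = 2 ^ 3 * 1 := by norm_num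
    rw [this]; exact ordTwoEq_twoPow_mul_odd 3 1 (by omega)
  exact branchAB_iv3 _ _ hA hB M hP n hn h7 hnAB hfree (32 * ℓ) hL32 (fun _ _ => True) hD32 hS32 x y z trivial hB3
    hxy hxy1 hxy2 hsol

end Summit.Ventures.AbcSig
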